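import Summits.QuantumFields.YangMills.Theorems.FiniteRankMirrorAssemblyKernel
import HarnessLib

/-!
# Route `FiniteRankMirror`, item `Assembly` (stmt-QuantumFields-25641): the multiplexing estimate at fixed `(β, L)`

Helper file (`--supports stmt-QuantumFields-25641`), second of the series (after `FiniteRankMirrorAssemblyKernel`).
For an ABSTRACT kernel `K : ℤ⁴ → ℤ⁴ → ℝ` that is invariant under spatial lattice translations and obeys the pointwise
mirror ceiling `|K(x,y)| ≤ C/‖(x₀+y₀, x⃗−y⃗)‖⁸` on positive-time sites of the window, and `J` modes `v_j` (time floor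
`δ`, radius `ℓ`, `|v_j| ≤ 1`, Lipschitz constant `M`), the multiplexed coefficient function
`F(y) = Σ_j v_j(s·y − jDℓ·e₁)` satisfies (`core_estimate`)
`Σ_j ΣΣ v_j(s·x) v_j(s·y) K(x,y) − J·(2MC(2ℓ+3)⁸/(2δ)⁸)·s − J²·C·5⁸/(D−2)⁸ ≤ ΣΣ F(x) F(y) K(x,y)`:
diagonal blocks (`diag_block`) by lattice rounding + translation invariance, cross blocks (`cross_block`) by the ceiling
at spatial separation `≥ (D−2)ℓ/s`.  Pure bookkeeping (plan `assembly_plan_25641.md`); no floor/NT claimed. -/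

set_option autoImplicit false

noncomputable section

open scoped SchwartzMap
open Literature.MathematicalPhysics.QuantumLattice Literature.Probability.LatticeModels

namespace Summit.QuantumFields.YangMills.Theorems.FiniteRankMirror

section Core

/-- **Diagonal block of the multiplexing estimate.**  For one mode `v` (time floor `δ`, radius `ℓ`, `|v| ≤ 1`,
Lipschitz `M`) and a physical offset `t·e₁` (`t ≥ 0`, `ℓ + s + t ≤ R ≤ s·L`), with a spatially translation-invariant
kernel obeying the mirror ceiling `C/‖(x₀+y₀, x⃗−y⃗)‖⁸` on positive-time sites of norm `≤ R`:
`ΣΣ v(s·x) v(s·y) K − (2MC(2ℓ+3)⁸/(2δ)⁸)·s ≤ ΣΣ v(s·x − t·e₁) v(s·y − t·e₁) K` — round `t·e₁` to the lattice vector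
`round(t/s)·e₁`, compare coefficientwise (`|Δ| ≤ M·s` on at most `((2ℓ+3s)/s)⁴` sites where the kernel is
`≤ C s⁸/(2δ)⁸`), then re-index the lattice translate. [folklore] -/
theorem diag_block (L : ℕ) (v : 𝓢(EuclideanSpace ℝ (Fin 4), ℝ)) (K : (Fin 4 → ℤ) → (Fin 4 → ℤ) → ℝ)
    {s ℓ δ M C t R : ℝ} (hs : 0 < s) (hsℓ : s ≤ ℓ) (hs1 : s ≤ 1) (hδ : 0 < δ) (hM : 0 ≤ M) (hC : 0 ≤ C)
    (ht : 0 ≤ t) (hR : ℓ + s + t ≤ R) (hRL : R ≤ s * L)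
    (hv0 : ∀ z, v z ≠ 0 → δ ≤ z 0) (hvℓ : ∀ z, v z ≠ 0 → ‖z‖ ≤ ℓ) (hv1 : ∀ z, |v z| ≤ 1)
    (hvM : ∀ z z', |v z - v z'| ≤ M * ‖z - z'‖)
    (hKtr : ∀ x y n : Fin 4 → ℤ, n 0 = 0 → K (x + n) (y + n) = K x y)
    (hKbd : ∀ x y : Fin 4 → ℤ, 1 ≤ x 0 → 1 ≤ y 0 → ‖s • siteToE x‖ ≤ R → ‖s • siteToE y‖ ≤ R →
      |K x y| ≤ C / ‖siteToE (Function.update (x - y) 0 (x 0 + y 0))‖ ^ 8) :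
    (∑ x ∈ box 4 L, ∑ y ∈ box 4 L, v (s • siteToE x) * v (s • siteToE y) * K x y) -
        (2 * M * C * (2 * ℓ + 3) ^ 8 / (2 * δ) ^ 8) * s ≤
      ∑ x ∈ box 4 L, ∑ y ∈ box 4 L,
        v (s • siteToE x - EuclideanSpace.single 1 t) * v (s • siteToE y - EuclideanSpace.single 1 t) * K x y := by
  classical
  have hℓ : 0 < ℓ := lt_of_lt_of_le hs hsℓ
  have hsub : ∀ y m : Fin 4 → ℤ, siteToE (y - m) = siteToE y - siteToE m := fun y m => by
    ext i; simp [siteToE_apply]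
  have hadd : ∀ y m : Fin 4 → ℤ, siteToE (y + m) = siteToE y + siteToE m := fun y m => by
    ext i; simp [siteToE_apply]
  obtain ⟨f, hf⟩ : ∃ f : (Fin 4 → ℤ) → ℝ, ∀ y, f y = v (s • siteToE y - EuclideanSpace.single 1 t) :=
    ⟨_, fun _ => rfl⟩
  obtain ⟨n, hn⟩ : ∃ n : Fin 4 → ℤ, n = Pi.single 1 (round (t / s)) := ⟨_, rfl⟩
  obtain ⟨h, hh⟩ : ∃ h : (Fin 4 → ℤ) → ℝ, ∀ y, h y = v (s • siteToE y) := ⟨_, fun _ => rfl⟩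
  obtain ⟨g, hg⟩ : ∃ g : (Fin 4 → ℤ) → ℝ, ∀ y, g y = h (y - n) := ⟨_, fun _ => rfl⟩
  set N : Finset (Fin 4 → ℤ) := (box 4 L).filter fun y => ‖s • siteToE y - EuclideanSpace.single 1 t‖ ≤ ℓ + s
    with hN
  have hct : ‖(EuclideanSpace.single (1 : Fin 4) t : EuclideanSpace ℝ (Fin 4))‖ = t := by
    rw [PiLp.norm_single, Real.norm_eq_abs, abs_of_nonneg ht]
  have hn0 : n 0 = 0 := by rw [hn]; simp
  have hround : ‖s • siteToE n - EuclideanSpace.single 1 t‖ ≤ s := by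
    rw [hn]; exact norm_smul_siteToE_single_round_sub_le hs t
  -- non-zero coefficients
  have hfnz : ∀ y, f y ≠ 0 → δ ≤ s * y 0 ∧ ‖s • siteToE y - EuclideanSpace.single 1 t‖ ≤ ℓ + s := by
    intro y hy
    rw [hf] at hy
    refine ⟨?_, (hvℓ _ hy).trans (by linarith)⟩
    have := hv0 _ hy
    rwa [smul_siteToE_sub_single_zero] at this
  have hgnz : ∀ y, g y ≠ 0 → δ ≤ s * y 0 ∧ ‖s • siteToE y - EuclideanSpace.single 1 t‖ ≤ ℓ + s := by
    intro y hy
    rw [hg, hh] at hy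
    constructor
    · have h0 := hv0 _ hy
      have e : (s • siteToE (y - n) : EuclideanSpace ℝ (Fin 4)) 0 = s * (y 0 : ℝ) := by
        simp [siteToE_apply, hn0]
      rwa [e] at h0
    · have h1 := hvℓ _ hy
      have e : s • siteToE (y - n) = (s • siteToE y - EuclideanSpace.single 1 t) -
          (s • siteToE n - EuclideanSpace.single 1 t) := by
        rw [hsub, smul_sub]; abel
      rw [e] at h1
      have := norm_sub_norm_le (s • siteToE y - EuclideanSpace.single 1 t) (s • siteToE n - EuclideanSpace.single 1 t)
      linarith
  have hfN : ∀ y ∈ box 4 L, f y ≠ 0 → y ∈ N := fun y hy hne => Finset.mem_filter.2 ⟨hy, (hfnz y hne).2⟩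
  have hgN : ∀ y ∈ box 4 L, g y ≠ 0 → y ∈ N := fun y hy hne => Finset.mem_filter.2 ⟨hy, (hgnz y hne).2⟩
  have hNsub : N ⊆ box 4 L := Finset.filter_subset _ _
  have hf1 : ∀ y, |f y| ≤ 1 := fun y => by rw [hf]; exact hv1 _
  have hg1 : ∀ y, |g y| ≤ 1 := fun y => by rw [hg, hh]; exact hv1 _
  have hfg : ∀ y, |f y - g y| ≤ M * s := by
    intro y
    rw [hf, hg, hh]
    refine (hvM _ _).trans (mul_le_mul_of_nonneg_left ?_ hM)
    have e : (s • siteToE y - EuclideanSpace.single 1 t) - s • siteToE (y - n) =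
        s • siteToE n - EuclideanSpace.single 1 t := by
      rw [hsub, smul_sub]; abel
    rw [e]; exact hround
  -- kernel bound on `N × N`
  have hKdiag : ∀ x ∈ N, ∀ y ∈ N, (f x ≠ 0 ∨ g x ≠ 0) → (f y ≠ 0 ∨ g y ≠ 0) →
      |K x y| ≤ C * s ^ 8 / (2 * δ) ^ 8 := by
    intro x _ y _ hx hy
    have hx' : δ ≤ s * x 0 ∧ ‖s • siteToE x - EuclideanSpace.single 1 t‖ ≤ ℓ + s := by
      rcases hx with hx | hx
      · exact hfnz x hx
      · exact hgnz x hx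
    have hy' : δ ≤ s * y 0 ∧ ‖s • siteToE y - EuclideanSpace.single 1 t‖ ≤ ℓ + s := by
      rcases hy with hy | hy
      · exact hfnz y hy
      · exact hgnz y hy
    obtain ⟨hx1, hxR, -⟩ := window_of_near L hs hδ ht hR hRL x hx'.1 hx'.2
    obtain ⟨hy1, hyR, -⟩ := window_of_near L hs hδ ht hR hRL y hy'.1 hy'.2
    have hsep : 2 * δ / s ≤ ‖siteToE (Function.update (x - y) 0 (x 0 + y 0))‖ := by
      have h2 : 2 * δ / s ≤ ((x 0 + y 0 : ℤ) : ℝ) := by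
        rw [div_le_iff₀ hs]; push_cast; linarith [hx'.1, hy'.1]
      exact h2.trans ((le_abs_self _).trans (abs_time_le_norm_mirrorSep x y))
    have := abs_le_div_pow_of_le hC (by positivity) hsep (hKbd x y hx1 hy1 hxR hyR)
    rw [div_pow] at this
    calc |K x y| ≤ C / ((2 * δ) ^ 8 / s ^ 8) := this
      _ = C * s ^ 8 / (2 * δ) ^ 8 := by field_simp
  -- in-box support of the un-translated coefficients
  have hhbox : ∀ y, h y ≠ 0 → y ∈ box 4 L ∧ y + n ∈ box 4 L := by
    intro y hy
    rw [hh] at hy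
    have h1 : ‖s • siteToE y‖ ≤ ℓ := hvℓ _ hy
    refine ⟨mem_box_of_norm_smul_le L hs y (by linarith), mem_box_of_norm_smul_le L hs _ ?_⟩
    have h2 : ‖s • siteToE n‖ ≤ s + t := by
      have := norm_sub_norm_le (s • siteToE n) (EuclideanSpace.single 1 t)
      rw [hct] at this
      linarith
    rw [hadd, smul_add]
    exact (norm_add_le _ _).trans (by linarith)
  -- lattice translate = original (re-indexing + translation invariance)
  have hshift : ∑ x ∈ box 4 L, ∑ y ∈ box 4 L, g x * g y * K x y =
      ∑ x ∈ box 4 L, ∑ y ∈ box 4 L, h x * h y * K x y := by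
    simp only [hg]
    rw [sum_sum_box_shift L h K n hhbox]
    refine Finset.sum_congr rfl fun x _ => Finset.sum_congr rfl fun y _ => ?_
    rw [hKtr x y n hn0]
  -- perturbation bound and counting
  have hpert := abs_sum_sum_sub_sum_sum_le (box 4 L) N hNsub f g K (δ := M * s) (M := C * s ^ 8 / (2 * δ) ^ 8)
    (by positivity) (by positivity) hfN hgN hf1 hg1 hfg hKdiag
  rw [hshift] at hpert
  have hNcard : (N.card : ℝ) ≤ ((2 * ℓ + 3 * s) / s) ^ 4 := by
    have := card_filter_norm_sub_le L hs (EuclideanSpace.single (1 : Fin 4) t) (ρ := ℓ + s) (by positivity)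
    rw [show 2 * (ℓ + s) + s = 2 * ℓ + 3 * s by ring] at this
    exact this
  have hNN : (N.card : ℝ) * N.card ≤ ((2 * ℓ + 3 * s) / s) ^ 4 * ((2 * ℓ + 3 * s) / s) ^ 4 :=
    mul_le_mul hNcard hNcard (by positivity) (by positivity)
  have hνν : ((2 * ℓ + 3 * s) / s) ^ 4 * ((2 * ℓ + 3 * s) / s) ^ 4 * s ^ 8 = (2 * ℓ + 3 * s) ^ 8 := by
    field_simp
  have hbound : 2 * ((N.card : ℝ) * N.card) * (M * s * (C * s ^ 8 / (2 * δ) ^ 8)) ≤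
      (2 * M * C * (2 * ℓ + 3) ^ 8 / (2 * δ) ^ 8) * s := by
    have h1 : 2 * ((N.card : ℝ) * N.card) * (M * s * (C * s ^ 8 / (2 * δ) ^ 8)) ≤
        2 * (((2 * ℓ + 3 * s) / s) ^ 4 * ((2 * ℓ + 3 * s) / s) ^ 4) * (M * s * (C * s ^ 8 / (2 * δ) ^ 8)) :=
      mul_le_mul_of_nonneg_right (mul_le_mul_of_nonneg_left hNN (by norm_num)) (by positivity)
    have h2 : 2 * (((2 * ℓ + 3 * s) / s) ^ 4 * ((2 * ℓ + 3 * s) / s) ^ 4) * (M * s * (C * s ^ 8 / (2 * δ) ^ 8)) =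
        (2 * M * C * (2 * ℓ + 3 * s) ^ 8 / (2 * δ) ^ 8) * s := by
      rw [← hνν]; ring
    have h3 : (2 * ℓ + 3 * s) ^ 8 ≤ (2 * ℓ + 3) ^ 8 := pow_le_pow_left₀ (by positivity) (by linarith) 8
    have h4 : (2 * M * C * (2 * ℓ + 3 * s) ^ 8 / (2 * δ) ^ 8) * s ≤
        (2 * M * C * (2 * ℓ + 3) ^ 8 / (2 * δ) ^ 8) * s := by
      apply mul_le_mul_of_nonneg_right _ hs.le
      apply div_le_div_of_nonneg_right _ (by positivity)
      exact mul_le_mul_of_nonneg_left h3 (by positivity)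
    linarith
  have key := (abs_sub_le_iff.1 (hpert.trans hbound)).2
  have eL : ∑ x ∈ box 4 L, ∑ y ∈ box 4 L, v (s • siteToE x) * v (s • siteToE y) * K x y =
      ∑ x ∈ box 4 L, ∑ y ∈ box 4 L, h x * h y * K x y := by simp only [hh]
  have eR : ∑ x ∈ box 4 L, ∑ y ∈ box 4 L,
      v (s • siteToE x - EuclideanSpace.single 1 t) * v (s • siteToE y - EuclideanSpace.single 1 t) * K x y =
      ∑ x ∈ box 4 L, ∑ y ∈ box 4 L, f x * f y * K x y := by simp only [hf]
  rw [eL, eR]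
  linarith

/-- **Cross block of the multiplexing estimate.**  Two modes `v, w` (time floor `δ`, radius `ℓ`, sup `≤ 1`) at
physical offsets `t·e₁`, `t'·e₁` with `|t − t'| ≥ m + 2ℓ` (`m > 0`): the mixed block is
`|ΣΣ v(s·x − t·e₁) w(s·y − t'·e₁) K| ≤ C(2ℓ+3s)⁸/m⁸` — the carrying sites are `≥ m/s` lattice units apart in the
first spatial direction, so the kernel is `≤ C s⁸/m⁸` there, on at most `((2ℓ+3s)/s)⁴` sites each. [folklore] -/
theorem cross_block (L : ℕ) (v w : 𝓢(EuclideanSpace ℝ (Fin 4), ℝ)) (K : (Fin 4 → ℤ) → (Fin 4 → ℤ) → ℝ)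
    {s ℓ δ C t t' R m : ℝ} (hs : 0 < s) (hsℓ : s ≤ ℓ) (hδ : 0 < δ) (hC : 0 ≤ C)
    (ht : 0 ≤ t) (ht' : 0 ≤ t') (hR : ℓ + s + t ≤ R) (hR' : ℓ + s + t' ≤ R) (hRL : R ≤ s * L)
    (hm : 0 < m) (hsep : m + 2 * ℓ ≤ |t - t'|)
    (hv0 : ∀ z, v z ≠ 0 → δ ≤ z 0) (hvℓ : ∀ z, v z ≠ 0 → ‖z‖ ≤ ℓ) (hv1 : ∀ z, |v z| ≤ 1)
    (hw0 : ∀ z, w z ≠ 0 → δ ≤ z 0) (hwℓ : ∀ z, w z ≠ 0 → ‖z‖ ≤ ℓ) (hw1 : ∀ z, |w z| ≤ 1)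
    (hKbd : ∀ x y : Fin 4 → ℤ, 1 ≤ x 0 → 1 ≤ y 0 → ‖s • siteToE x‖ ≤ R → ‖s • siteToE y‖ ≤ R →
      |K x y| ≤ C / ‖siteToE (Function.update (x - y) 0 (x 0 + y 0))‖ ^ 8) :
    |∑ x ∈ box 4 L, ∑ y ∈ box 4 L,
        v (s • siteToE x - EuclideanSpace.single 1 t) * w (s • siteToE y - EuclideanSpace.single 1 t') * K x y| ≤
      C * (2 * ℓ + 3 * s) ^ 8 / m ^ 8 := by
  classical
  have hℓ : 0 < ℓ := lt_of_lt_of_le hs hsℓ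
  obtain ⟨f, hf⟩ : ∃ f : (Fin 4 → ℤ) → ℝ, ∀ y, f y = v (s • siteToE y - EuclideanSpace.single 1 t) :=
    ⟨_, fun _ => rfl⟩
  obtain ⟨g, hg⟩ : ∃ g : (Fin 4 → ℤ) → ℝ, ∀ y, g y = w (s • siteToE y - EuclideanSpace.single 1 t') :=
    ⟨_, fun _ => rfl⟩
  set Nf : Finset (Fin 4 → ℤ) := (box 4 L).filter fun y => ‖s • siteToE y - EuclideanSpace.single 1 t‖ ≤ ℓ + s
    with hNf
  set Ng : Finset (Fin 4 → ℤ) := (box 4 L).filter fun y => ‖s • siteToE y - EuclideanSpace.single 1 t'‖ ≤ ℓ + s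
    with hNg
  have hfnz : ∀ y, f y ≠ 0 → δ ≤ s * y 0 ∧ ‖s • siteToE y - EuclideanSpace.single 1 t‖ ≤ ℓ := by
    intro y hy
    rw [hf] at hy
    refine ⟨?_, hvℓ _ hy⟩
    have := hv0 _ hy
    rwa [smul_siteToE_sub_single_zero] at this
  have hgnz : ∀ y, g y ≠ 0 → δ ≤ s * y 0 ∧ ‖s • siteToE y - EuclideanSpace.single 1 t'‖ ≤ ℓ := by
    intro y hy
    rw [hg] at hy
    refine ⟨?_, hwℓ _ hy⟩
    have := hw0 _ hy
    rwa [smul_siteToE_sub_single_zero] at this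
  have hfN : ∀ y ∈ box 4 L, f y ≠ 0 → y ∈ Nf := fun y hy hne =>
    Finset.mem_filter.2 ⟨hy, (hfnz y hne).2.trans (by linarith)⟩
  have hgN : ∀ y ∈ box 4 L, g y ≠ 0 → y ∈ Ng := fun y hy hne =>
    Finset.mem_filter.2 ⟨hy, (hgnz y hne).2.trans (by linarith)⟩
  have hf1 : ∀ y, |f y| ≤ 1 := fun y => by rw [hf]; exact hv1 _
  have hg1 : ∀ y, |g y| ≤ 1 := fun y => by rw [hg]; exact hw1 _
  have hK : ∀ x ∈ Nf, ∀ y ∈ Ng, f x ≠ 0 → g y ≠ 0 → |K x y| ≤ C * s ^ 8 / m ^ 8 := by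
    intro x _ y _ hx hy
    obtain ⟨hx0, hxℓ⟩ := hfnz x hx
    obtain ⟨hy0, hyℓ⟩ := hgnz y hy
    obtain ⟨hx1, hxR, -⟩ := window_of_near L hs hδ ht hR hRL x hx0 (hxℓ.trans (by linarith))
    obtain ⟨hy1, hyR, -⟩ := window_of_near L hs hδ ht' hR' hRL y hy0 (hyℓ.trans (by linarith))
    have hsep' : m / s ≤ ‖siteToE (Function.update (x - y) 0 (x 0 + y 0))‖ := by
      have ex : |s * (x 1 : ℝ) - t| ≤ ℓ := by
        have := PiLp.norm_apply_le (s • siteToE x - EuclideanSpace.single (1 : Fin 4) t) 1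
        rw [smul_siteToE_sub_single_one, Real.norm_eq_abs] at this
        exact this.trans hxℓ
      have ey : |s * (y 1 : ℝ) - t'| ≤ ℓ := by
        have := PiLp.norm_apply_le (s • siteToE y - EuclideanSpace.single (1 : Fin 4) t') 1
        rw [smul_siteToE_sub_single_one, Real.norm_eq_abs] at this
        exact this.trans hyℓ
      have tri : |t - t'| ≤ |s * (x 1 : ℝ) - t| + |s * (y 1 : ℝ) - t'| + |s * ((x 1 : ℝ) - y 1)| := by
        have e : t - t' = -(s * (x 1 : ℝ) - t) + (s * (y 1 : ℝ) - t') + s * ((x 1 : ℝ) - y 1) := by ring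
        rw [e]
        refine (abs_add_le _ _).trans (add_le_add ((abs_add_le _ _).trans (add_le_add ?_ le_rfl)) le_rfl)
        rw [abs_neg]
      have h3 : m ≤ s * |((x 1 - y 1 : ℤ) : ℝ)| := by
        push_cast
        rw [← abs_of_pos hs, ← abs_mul]
        linarith
      have h4 : m / s ≤ |((x 1 - y 1 : ℤ) : ℝ)| := by
        rw [div_le_iff₀ hs]; linarith
      exact h4.trans (abs_space_le_norm_mirrorSep x y)
    have := abs_le_div_pow_of_le hC (by positivity) hsep' (hKbd x y hx1 hy1 hxR hyR)
    rw [div_pow] at this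
    calc |K x y| ≤ C / (m ^ 8 / s ^ 8) := this
      _ = C * s ^ 8 / m ^ 8 := by field_simp
  have hb := abs_sum_sum_le_card_mul (box 4 L) Nf Ng (Finset.filter_subset _ _) (Finset.filter_subset _ _) f g K
    zero_le_one zero_le_one (by positivity : (0 : ℝ) ≤ C * s ^ 8 / m ^ 8) hfN hgN hf1 hg1 hK
  have hNf' : (Nf.card : ℝ) ≤ ((2 * ℓ + 3 * s) / s) ^ 4 := by
    have := card_filter_norm_sub_le L hs (EuclideanSpace.single (1 : Fin 4) t) (ρ := ℓ + s) (by positivity)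
    rw [show 2 * (ℓ + s) + s = 2 * ℓ + 3 * s by ring] at this
    exact this
  have hNg' : (Ng.card : ℝ) ≤ ((2 * ℓ + 3 * s) / s) ^ 4 := by
    have := card_filter_norm_sub_le L hs (EuclideanSpace.single (1 : Fin 4) t') (ρ := ℓ + s) (by positivity)
    rw [show 2 * (ℓ + s) + s = 2 * ℓ + 3 * s by ring] at this
    exact this
  have hNN : (Nf.card : ℝ) * Ng.card ≤ ((2 * ℓ + 3 * s) / s) ^ 4 * ((2 * ℓ + 3 * s) / s) ^ 4 :=
    mul_le_mul hNf' hNg' (by positivity) (by positivity)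
  have hνν : ((2 * ℓ + 3 * s) / s) ^ 4 * ((2 * ℓ + 3 * s) / s) ^ 4 * s ^ 8 = (2 * ℓ + 3 * s) ^ 8 := by
    field_simp
  have e : ∑ x ∈ box 4 L, ∑ y ∈ box 4 L,
      v (s • siteToE x - EuclideanSpace.single 1 t) * w (s • siteToE y - EuclideanSpace.single 1 t') * K x y =
      ∑ x ∈ box 4 L, ∑ y ∈ box 4 L, f x * g y * K x y := by simp only [hf, hg]
  rw [e]
  refine hb.trans ?_
  have h1 : (Nf.card : ℝ) * Ng.card * (1 * 1 * (C * s ^ 8 / m ^ 8)) ≤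
      ((2 * ℓ + 3 * s) / s) ^ 4 * ((2 * ℓ + 3 * s) / s) ^ 4 * (1 * 1 * (C * s ^ 8 / m ^ 8)) :=
    mul_le_mul_of_nonneg_right hNN (by positivity)
  have h2 : ((2 * ℓ + 3 * s) / s) ^ 4 * ((2 * ℓ + 3 * s) / s) ^ 4 * (1 * 1 * (C * s ^ 8 / m ^ 8)) =
      C * (2 * ℓ + 3 * s) ^ 8 / m ^ 8 := by
    rw [← hνν]; ring
  linarith

/-- **The multiplexing estimate at fixed torus `2L+1`, spacing `s` and kernel `K`.**  Let `K : ℤ⁴ → ℤ⁴ → ℝ` be invariant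
under spatial lattice translations and obey the pointwise mirror ceiling `|K(x,y)| ≤ C/‖(x₀+y₀, x⃗−y⃗)‖⁸` for
positive-time sites with `‖s·x‖, ‖s·y‖ ≤ R := (J·D+2)·ℓ`, `R ≤ s·L`.  Let `v₀ … v_{J−1}` be modes with `v_j(z) ≠ 0 ⇒
δ ≤ z₀ ∧ ‖z‖ ≤ ℓ`, `|v_j| ≤ 1`, `|v_j(z) − v_j(z')| ≤ M‖z − z'‖`, and `0 < s ≤ min(ℓ,1)`, `D ≥ 3`.  Then the multiplexed
coefficient function `F(y) = Σ_j v_j(s·y − jDℓ·e₁)` satisfies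
`Σ_j ΣΣ v_j(s·x) v_j(s·y) K(x,y) − J·(2MC(2ℓ+3)⁸/(2δ)⁸)·s − J²·(C·5⁸/(D−2)⁸) ≤ ΣΣ F(x) F(y) K(x,y)`
(diagonal blocks `diag_block`, cross blocks `cross_block` with `m = (D−2)ℓ`). [folklore] -/
theorem core_estimate (L : ℕ) {J : ℕ} (v : Fin J → 𝓢(EuclideanSpace ℝ (Fin 4), ℝ))
    (K : (Fin 4 → ℤ) → (Fin 4 → ℤ) → ℝ)
    {s ℓ δ M C D : ℝ} (hs : 0 < s) (hsℓ : s ≤ ℓ) (hs1 : s ≤ 1) (hδ : 0 < δ) (hM : 0 ≤ M) (hC : 0 ≤ C)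
    (hD : 3 ≤ D)
    (hv0 : ∀ j z, v j z ≠ 0 → δ ≤ z 0) (hvℓ : ∀ j z, v j z ≠ 0 → ‖z‖ ≤ ℓ) (hv1 : ∀ j z, |v j z| ≤ 1)
    (hvM : ∀ j z z', |v j z - v j z'| ≤ M * ‖z - z'‖)
    (hroom : ((J : ℝ) * D + 2) * ℓ ≤ s * L)
    (hKtr : ∀ x y n : Fin 4 → ℤ, n 0 = 0 → K (x + n) (y + n) = K x y)
    (hKbd : ∀ x y : Fin 4 → ℤ, 1 ≤ x 0 → 1 ≤ y 0 → ‖s • siteToE x‖ ≤ ((J : ℝ) * D + 2) * ℓ →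
      ‖s • siteToE y‖ ≤ ((J : ℝ) * D + 2) * ℓ →
      |K x y| ≤ C / ‖siteToE (Function.update (x - y) 0 (x 0 + y 0))‖ ^ 8) :
    (∑ j, ∑ x ∈ box 4 L, ∑ y ∈ box 4 L, v j (s • siteToE x) * v j (s • siteToE y) * K x y) -
        J * (2 * M * C * (2 * ℓ + 3) ^ 8 / (2 * δ) ^ 8) * s - (J : ℝ) ^ 2 * (C * 5 ^ 8 / (D - 2) ^ 8) ≤
      ∑ x ∈ box 4 L, ∑ y ∈ box 4 L,
        (∑ j, v j (s • siteToE x - EuclideanSpace.single 1 (((j : ℕ) : ℝ) * D * ℓ))) *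
          (∑ j, v j (s • siteToE y - EuclideanSpace.single 1 (((j : ℕ) : ℝ) * D * ℓ))) * K x y := by
  classical
  have hℓ : 0 < ℓ := lt_of_lt_of_le hs hsℓ
  have hD0 : 0 ≤ D := by linarith
  set R : ℝ := ((J : ℝ) * D + 2) * ℓ with hR
  obtain ⟨t, ht⟩ : ∃ t : Fin J → ℝ, ∀ j, t j = ((j : ℕ) : ℝ) * D * ℓ := ⟨_, fun _ => rfl⟩
  obtain ⟨f, hf⟩ : ∃ f : Fin J → (Fin 4 → ℤ) → ℝ,
      ∀ j y, f j y = v j (s • siteToE y - EuclideanSpace.single 1 (t j)) := ⟨_, fun _ _ => rfl⟩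
  -- offsets
  have ht0 : ∀ j, 0 ≤ t j := fun j => by rw [ht]; positivity
  have htR : ∀ j, ℓ + s + t j ≤ R := by
    intro j
    rw [ht, hR]
    have hj : ((j : ℕ) : ℝ) + 1 ≤ J := by exact_mod_cast j.isLt
    nlinarith [mul_nonneg hD0 hℓ.le, hsℓ]
  have htsep : ∀ j k : Fin J, j ≠ k → (D - 2) * ℓ + 2 * ℓ ≤ |t j - t k| := by
    intro j k hjk
    have h1 : (1 : ℝ) ≤ |((j : ℕ) : ℝ) - (k : ℕ)| := by
      rcases Nat.lt_or_gt_of_ne (Fin.val_ne_of_ne hjk) with h | h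
      · have : ((j : ℕ) : ℝ) + 1 ≤ (k : ℕ) := by exact_mod_cast h
        rw [abs_of_nonpos (by linarith)]; linarith
      · have : ((k : ℕ) : ℝ) + 1 ≤ (j : ℕ) := by exact_mod_cast h
        rw [abs_of_nonneg (by linarith)]; linarith
    rw [ht, ht, show ((j : ℕ) : ℝ) * D * ℓ - ((k : ℕ) : ℝ) * D * ℓ = (((j : ℕ) : ℝ) - (k : ℕ)) * (D * ℓ) by ring,
      abs_mul, abs_of_nonneg (by positivity : 0 ≤ D * ℓ)]
    nlinarith [mul_nonneg hD0 hℓ.le]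
  -- the blocks
  set a : Fin J → Fin J → ℝ := fun j k => ∑ x ∈ box 4 L, ∑ y ∈ box 4 L, f j x * f k y * K x y with ha
  have step1 : ∑ x ∈ box 4 L, ∑ y ∈ box 4 L,
      (∑ j, v j (s • siteToE x - EuclideanSpace.single 1 (((j : ℕ) : ℝ) * D * ℓ))) *
        (∑ j, v j (s • siteToE y - EuclideanSpace.single 1 (((j : ℕ) : ℝ) * D * ℓ))) * K x y =
      ∑ j, ∑ k, a j k := by
    rw [ha, ← sum_sum_sum_coeff_expand Finset.univ (box 4 L) f K]
    simp only [hf, ht]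
  have step2 : ∀ j, (∑ x ∈ box 4 L, ∑ y ∈ box 4 L, v j (s • siteToE x) * v j (s • siteToE y) * K x y) -
      (2 * M * C * (2 * ℓ + 3) ^ 8 / (2 * δ) ^ 8) * s ≤ a j j := by
    intro j
    have := diag_block L (v j) K hs hsℓ hs1 hδ hM hC (ht0 j) (htR j) hroom (hv0 j) (hvℓ j) (hv1 j) (hvM j)
      hKtr hKbd
    simpa only [ha, hf] using this
  have step3 : ∀ j k, j ≠ k → |a j k| ≤ C * 5 ^ 8 / (D - 2) ^ 8 := by
    intro j k hjk
    have hm : 0 < (D - 2) * ℓ := by nlinarith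
    have hb := cross_block L (v j) (v k) K hs hsℓ hδ hC (ht0 j) (ht0 k) (htR j) (htR k) hroom hm (htsep j k hjk)
      (hv0 j) (hvℓ j) (hv1 j) (hv0 k) (hvℓ k) (hv1 k) hKbd
    have e : a j k = ∑ x ∈ box 4 L, ∑ y ∈ box 4 L,
        v j (s • siteToE x - EuclideanSpace.single 1 (t j)) * v k (s • siteToE y - EuclideanSpace.single 1 (t k)) *
          K x y := by simp only [ha, hf]
    rw [e]
    refine hb.trans ?_
    have h3 : (2 * ℓ + 3 * s) ^ 8 ≤ (5 * ℓ) ^ 8 := pow_le_pow_left₀ (by positivity) (by linarith) 8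
    have h4 : C * (2 * ℓ + 3 * s) ^ 8 / ((D - 2) * ℓ) ^ 8 ≤ C * (5 * ℓ) ^ 8 / ((D - 2) * ℓ) ^ 8 :=
      div_le_div_of_nonneg_right (mul_le_mul_of_nonneg_left h3 hC) (by positivity)
    have h5 : C * (5 * ℓ) ^ 8 / ((D - 2) * ℓ) ^ 8 = C * 5 ^ 8 / (D - 2) ^ 8 := by
      rw [mul_pow, mul_pow]
      have hD2 : 0 < D - 2 := by linarith
      have : ℓ ^ 8 ≠ 0 := by positivity
      have : (D - 2) ^ 8 ≠ 0 := by positivity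
      field_simp
    linarith
  -- assemble
  have step4 : ∑ j, ∑ k, a j k = ∑ j, a j j + ∑ j, ∑ k ∈ Finset.univ.erase j, a j k := by
    rw [← Finset.sum_add_distrib]
    refine Finset.sum_congr rfl fun j _ => ?_
    rw [Finset.add_sum_erase _ _ (Finset.mem_univ j)]
  have hdiag : (∑ j, ∑ x ∈ box 4 L, ∑ y ∈ box 4 L, v j (s • siteToE x) * v j (s • siteToE y) * K x y) -
      J * (2 * M * C * (2 * ℓ + 3) ^ 8 / (2 * δ) ^ 8) * s ≤ ∑ j, a j j := by
    have e : (∑ j, ∑ x ∈ box 4 L, ∑ y ∈ box 4 L, v j (s • siteToE x) * v j (s • siteToE y) * K x y) -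
        J * (2 * M * C * (2 * ℓ + 3) ^ 8 / (2 * δ) ^ 8) * s =
        ∑ j : Fin J, ((∑ x ∈ box 4 L, ∑ y ∈ box 4 L, v j (s • siteToE x) * v j (s • siteToE y) * K x y) -
          (2 * M * C * (2 * ℓ + 3) ^ 8 / (2 * δ) ^ 8) * s) := by
      rw [Finset.sum_sub_distrib, Finset.sum_const, Finset.card_univ, Fintype.card_fin, nsmul_eq_mul]
      ring
    rw [e]
    exact Finset.sum_le_sum fun j _ => step2 j
  have hcross : -((J : ℝ) ^ 2 * (C * 5 ^ 8 / (D - 2) ^ 8)) ≤ ∑ j, ∑ k ∈ Finset.univ.erase j, a j k := by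
    have h1 : ∀ j : Fin J, -((J : ℝ) * (C * 5 ^ 8 / (D - 2) ^ 8)) ≤ ∑ k ∈ Finset.univ.erase j, a j k := by
      intro j
      have h2 : ∑ k ∈ Finset.univ.erase j, -(C * 5 ^ 8 / (D - 2) ^ 8) ≤ ∑ k ∈ Finset.univ.erase j, a j k :=
        Finset.sum_le_sum fun k hk => by
          have hkj : j ≠ k := fun e => (Finset.mem_erase.1 hk).1 e.symm
          linarith [neg_abs_le (a j k), step3 j k hkj]
      have h3 : -((J : ℝ) * (C * 5 ^ 8 / (D - 2) ^ 8)) ≤ ∑ k ∈ Finset.univ.erase j, -(C * 5 ^ 8 / (D - 2) ^ 8) := by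
        rw [Finset.sum_const, Finset.card_erase_of_mem (Finset.mem_univ j), Finset.card_univ, Fintype.card_fin,
          nsmul_eq_mul]
        have hc0 : 0 ≤ C * 5 ^ 8 / (D - 2) ^ 8 := by positivity
        have hJ : ((J - 1 : ℕ) : ℝ) ≤ J := by exact_mod_cast Nat.sub_le J 1
        nlinarith
      linarith
    have h4 : ∑ j : Fin J, -((J : ℝ) * (C * 5 ^ 8 / (D - 2) ^ 8)) ≤ ∑ j, ∑ k ∈ Finset.univ.erase j, a j k :=
      Finset.sum_le_sum fun j _ => h1 j
    rw [Finset.sum_const, Finset.card_univ, Fintype.card_fin, nsmul_eq_mul] at h4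
    have e : (J : ℝ) * -((J : ℝ) * (C * 5 ^ 8 / (D - 2) ^ 8)) = -((J : ℝ) ^ 2 * (C * 5 ^ 8 / (D - 2) ^ 8)) := by ring
    linarith
  rw [step1, step4]
  linarith

end Core

end Summit.QuantumFields.YangMills.Theorems.FiniteRankMirror

end
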